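import Summits.ValiantsHypothesis.ValiantsHypothesis.Theses.PolyaContinued
import Summits.ValiantsHypothesis.ValiantsHypothesis.Theorems.PolyaContinuedMonotoneCoverHardLevelFunction

/-!
# Crux `MonotoneCoverHard` (stmt-ValiantsHypothesis-7421): `MonotoneCoverHard` FOLLOWS FROM THE WIDTH BET

Assembly of the width line in kernel (val-width-7421-p2 g0, 2026-08-27).  The WIDTH BET is the purely
structural statement

  `WidthBet`: uniformly (`∃ d n₀`), for every label-bijective Pfaffian cover `(m, E, a)` of `per_n`
  (`n ≥ n₀`) and every level function `g` on its USED edges (`g(col) = g(row) + [label is a variable]`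
  along every edge of every weight-nonzero perfect matching), some level `h ≥ 1` is balanced (every
  weight-nonzero matching has between `n/3` and `2n/3` variable edges with row level `< h`) and the
  widths `c_h, c_{h-1}` (numbers of variable edges of the matchings leaving row levels `h`, `h - 1`)
  satisfy `c_h + c_{h-1} ≤ (log₂ m + d)^d`,

spelled out inline as the hypothesis of `monotoneCoverHard_of_widthBet`.  Everything else is proved:

* `rectangleBound_of_labels`, `two_pow_le_pow_width_of_labels` — val-width-7421-p1's rectangle bound
  and this seat's width rung WITHOUT the (unused) Pfaffian hypothesis, so that they apply to the
  sub-cover of used edges;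
* `good_usedEdges_iff`, `perIdentity_usedEdges`, `used_usedEdges` — discarding unused edges keeps the
  weight-nonzero perfect matchings, the identity `per_n = aeval a PM_E` and makes every nonzero edge
  used, so `exists_level_function` (…LevelFunction.lean) provides a level function;
* `monotoneCoverHard_of_widthBet` — **WidthBet → MonotoneCoverHard**: for a purported quasi-polynomial
  cover take the level function of its used-edge sub-cover, let the bet pick a thin balanced level, and
  run `2^(n/3) ≤ m^(c_h + c_{h-1}) ≤ 2^((log₂ m + 1)(log₂ m + d)^d)` against `polylog < linear`
  (`qp_exponent_le`, `polylog_lt_two_pow_div_three`, the strategist's arithmetic from the line skeleton).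

So the crux is reduced, in kernel, to ONE structural statement about Pfaffian bipartite graphs carrying a
permutation-bijective matching family: no balanced level is forced to be wide.  VP ≠ VNP is not moved;
`MonotoneCoverHard` itself stays open (the bet is open).  No definitions.
-/

namespace Summit.ValiantsHypothesis.ValiantsHypothesis.Theorems.PolyaContinuedMonotoneCoverHard

-- summit = sub-problem name (single-conjunct summit, D-0017 layout), so the namespace repeats it
set_option linter.dupNamespace false

open scoped Classical
open Finset
open Summit.ValiantsHypothesis.ValiantsHypothesis.Theses.PolyaContinued (MonotoneCoverHard)
open Summit.ValiantsHypothesis.ValiantsHypothesis.Theorems.PolyaContinued.MonotoneCoverHardRectangle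
  (exists_labels aeval_permanent_cover perPoly_eq_sum_monomial label_bijection pexp_injective
    two_pow_le_card_states)

/-- The rectangle bound of `stub_rectangleBound` (val-width-7421-p1) without its unused Pfaffian
hypothesis: a balanced vertex cut of a label-bijective cover has at least `2^(n/3)` crossing states. -/
theorem rectangleBound_of_labels (n m : ℕ) (E : Finset (Fin m × Fin m))
    (a : Fin m × Fin m → MvPolynomial (Fin n × Fin n) ℂ)
    (ha : ∀ e, (∃ j, a e = MvPolynomial.X j) ∨ a e = 0 ∨ a e = 1)
    (hper : Literature.Computability.AlgebraicComplexity.perPoly (Fin n) ℂ =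
      MvPolynomial.aeval a (Matrix.of fun i j => if (i, j) ∈ E then MvPolynomial.X (i, j) else 0 :
          Matrix (Fin m) (Fin m) (MvPolynomial (Fin m × Fin m) ℂ)).permanent)
    (S : Finset (Fin m ⊕ Fin m))
    (hbal : ∀ τ : Equiv.Perm (Fin m), (∀ i, (i, τ i) ∈ E ∧ a (i, τ i) ≠ 0) →
      n ≤ 3 * (Finset.univ.filter fun i : Fin m =>
          Sum.inl i ∈ S ∧ Sum.inr (τ i) ∈ S ∧ ∃ j, a (i, τ i) = MvPolynomial.X j).card ∧
      3 * (Finset.univ.filter fun i : Fin m =>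
          Sum.inl i ∈ S ∧ Sum.inr (τ i) ∈ S ∧ ∃ j, a (i, τ i) = MvPolynomial.X j).card ≤ 2 * n) :
    2 ^ (n / 3) ≤
      ((Finset.univ.filter fun τ : Equiv.Perm (Fin m) => ∀ i, (i, τ i) ∈ E ∧ a (i, τ i) ≠ 0).image
        (fun τ : Equiv.Perm (Fin m) => (Finset.univ.filter fun i : Fin m =>
          (Sum.inl i ∈ S ∧ Sum.inr (τ i) ∉ S) ∨ (Sum.inl i ∉ S ∧ Sum.inr (τ i) ∈ S)).image
            fun i => (i, τ i))).card := by
  obtain ⟨δ, hδ, hδ1, hδ0⟩ := exists_labels a ha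
  set G := Finset.univ.filter fun τ : Equiv.Perm (Fin m) => ∀ i, (i, τ i) ∈ E ∧ a (i, τ i) ≠ 0
    with hG
  have hsum : ∑ τ ∈ G, MvPolynomial.monomial (∑ i, δ (i, τ i)) (1 : ℂ) =
      ∑ σ : Equiv.Perm (Fin n), MvPolynomial.monomial (∑ k, Finsupp.single (k, σ k) 1) (1 : ℂ) := by
    rw [← aeval_permanent_cover E a δ hδ G hG, ← hper, perPoly_eq_sum_monomial]
  obtain ⟨hinj, himg, hsurj⟩ := label_bijection G (fun τ => ∑ i, δ (i, τ i))
    (fun σ : Equiv.Perm (Fin n) => ∑ k, Finsupp.single (k, σ k) (1 : ℕ)) pexp_injective hsum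
  have hdeg : ∀ e, Finsupp.degree (δ e) = if (∃ j, a e = MvPolynomial.X j) then 1 else 0 := by
    intro e
    split_ifs with h
    · exact hδ1 e h
    · rw [hδ0 e h, map_zero]
  have hcount : ∀ τ : Equiv.Perm (Fin m),
      (Finset.univ.filter fun i : Fin m =>
          Sum.inl i ∈ S ∧ Sum.inr (τ i) ∈ S ∧ ∃ j, a (i, τ i) = MvPolynomial.X j).card =
        Finsupp.degree (∑ i ∈ Finset.univ.filter
          (fun i : Fin m => Sum.inl i ∈ S ∧ Sum.inr (τ i) ∈ S), δ (i, τ i)) := by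
    intro τ
    rw [map_sum]
    simp_rw [hdeg]
    rw [Finset.sum_boole, Nat.cast_id, Finset.filter_filter]
    congr 1
    exact Finset.filter_congr fun i _ => and_assoc.symm
  refine two_pow_le_card_states S δ (fun e => e ∈ E ∧ a e ≠ 0) G
    (fun τ => ∑ i, δ (i, τ i)) _ _ _ _ _ (fun τ => by rw [hG]; simp) (fun _ => rfl) (fun _ => rfl)
    (fun _ => rfl) (fun _ => rfl) (fun _ => rfl) (fun _ => rfl) hinj himg hsurj ?_
  intro τ hτ
  rw [← hcount τ]
  exact hbal τ (by rw [hG] at hτ; exact (Finset.mem_filter.1 hτ).2)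

/-- The width rung without the Pfaffian hypothesis: `2^(n/3) ≤ m^(c_h + c_{h-1})` for every cover with
a level function (on all its nonzero edges) and a balanced level `h` of widths `c_h, c_{h-1}`. -/
theorem two_pow_le_pow_width_of_labels (n m : ℕ) (E : Finset (Fin m × Fin m))
    (a : Fin m × Fin m → MvPolynomial (Fin n × Fin n) ℂ)
    (ha : ∀ e, (∃ j, a e = MvPolynomial.X j) ∨ a e = 0 ∨ a e = 1)
    (hper : Literature.Computability.AlgebraicComplexity.perPoly (Fin n) ℂ =
      MvPolynomial.aeval a (Matrix.of fun i j => if (i, j) ∈ E then MvPolynomial.X (i, j) else 0 :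
          Matrix (Fin m) (Fin m) (MvPolynomial (Fin m × Fin m) ℂ)).permanent)
    (g : Fin m ⊕ Fin m → ℕ) (h ch cq : ℕ) (h1 : 1 ≤ h)
    (hvar : ∀ i j, (i, j) ∈ E → (∃ k, a (i, j) = MvPolynomial.X k) →
      g (Sum.inr j) = g (Sum.inl i) + 1)
    (hone : ∀ i j, (i, j) ∈ E → a (i, j) ≠ 0 → (¬ ∃ k, a (i, j) = MvPolynomial.X k) →
      g (Sum.inr j) = g (Sum.inl i))
    (hwin : ∀ τ : Equiv.Perm (Fin m), (∀ i, (i, τ i) ∈ E ∧ a (i, τ i) ≠ 0) →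
      n ≤ 3 * (univ.filter fun i : Fin m =>
          (∃ k, a (i, τ i) = MvPolynomial.X k) ∧ g (Sum.inl i) < h).card ∧
        3 * (univ.filter fun i : Fin m =>
          (∃ k, a (i, τ i) = MvPolynomial.X k) ∧ g (Sum.inl i) < h).card ≤ 2 * n)
    (hch : ∀ τ : Equiv.Perm (Fin m), (∀ i, (i, τ i) ∈ E ∧ a (i, τ i) ≠ 0) →
      (univ.filter fun i : Fin m =>
        (∃ k, a (i, τ i) = MvPolynomial.X k) ∧ g (Sum.inl i) = h).card = ch)
    (hcq : ∀ τ : Equiv.Perm (Fin m), (∀ i, (i, τ i) ∈ E ∧ a (i, τ i) ≠ 0) →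
      (univ.filter fun i : Fin m =>
        (∃ k, a (i, τ i) = MvPolynomial.X k) ∧ g (Sum.inl i) = h - 1).card = cq) :
    2 ^ (n / 3) ≤ m ^ (ch + cq) := by
  obtain ⟨S, hbal, hcard⟩ := exists_balanced_cut_card_le_pow_of_width n E a g h ch cq h1 hvar hone
    hwin hch hcq (fun τ τ' hτ hτ' hh => eq_of_agree_on_var E a ha hper τ τ' hτ hτ' hh)
  exact (rectangleBound_of_labels n m E a ha hper S hbal).trans hcard

/-! ### Reduction to used edges -/

section Used

variable {m n : ℕ} (E : Finset (Fin m × Fin m)) (a : Fin m × Fin m → MvPolynomial (Fin n × Fin n) ℂ)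

/-- Weight-nonzero perfect matchings of the used-edge sub-cover are those of the cover. -/
theorem good_usedEdges_iff (τ : Equiv.Perm (Fin m)) :
    (∀ i, (i, τ i) ∈ E.filter (fun e => a e ≠ 0 ∧ ∃ σ : Equiv.Perm (Fin m),
        (∀ k, (k, σ k) ∈ E ∧ a (k, σ k) ≠ 0) ∧ σ e.1 = e.2) ∧ a (i, τ i) ≠ 0) ↔
      (∀ i, (i, τ i) ∈ E ∧ a (i, τ i) ≠ 0) := by
  constructor
  · intro h i
    exact ⟨(Finset.mem_filter.1 (h i).1).1, (h i).2⟩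
  · intro h i
    exact ⟨Finset.mem_filter.2 ⟨(h i).1, (h i).2, τ, h, rfl⟩, (h i).2⟩

/-- The identity `per_n = aeval a PM_E` survives discarding the unused edges. -/
theorem perIdentity_usedEdges
    (ha : ∀ e, (∃ j, a e = MvPolynomial.X j) ∨ a e = 0 ∨ a e = 1)
    (hper : Literature.Computability.AlgebraicComplexity.perPoly (Fin n) ℂ =
      MvPolynomial.aeval a (Matrix.of fun i j => if (i, j) ∈ E then MvPolynomial.X (i, j) else 0 :
          Matrix (Fin m) (Fin m) (MvPolynomial (Fin m × Fin m) ℂ)).permanent) :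
    Literature.Computability.AlgebraicComplexity.perPoly (Fin n) ℂ =
      MvPolynomial.aeval a (Matrix.of fun i j =>
        if (i, j) ∈ E.filter (fun e => a e ≠ 0 ∧ ∃ σ : Equiv.Perm (Fin m),
            (∀ k, (k, σ k) ∈ E ∧ a (k, σ k) ≠ 0) ∧ σ e.1 = e.2)
        then MvPolynomial.X (i, j) else 0 :
          Matrix (Fin m) (Fin m) (MvPolynomial (Fin m × Fin m) ℂ)).permanent := by
  obtain ⟨δ, hδ, -, -⟩ := exists_labels a ha
  set G := Finset.univ.filter fun τ : Equiv.Perm (Fin m) => ∀ i, (i, τ i) ∈ E ∧ a (i, τ i) ≠ 0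
    with hG
  have hG' : G = Finset.univ.filter fun τ : Equiv.Perm (Fin m) => ∀ i,
      (i, τ i) ∈ E.filter (fun e => a e ≠ 0 ∧ ∃ σ : Equiv.Perm (Fin m),
        (∀ k, (k, σ k) ∈ E ∧ a (k, σ k) ≠ 0) ∧ σ e.1 = e.2) ∧ a (i, τ i) ≠ 0 := by
    rw [hG]
    exact Finset.filter_congr fun τ _ => (good_usedEdges_iff E a τ).symm
  rw [hper, aeval_permanent_cover E a δ hδ G hG, aeval_permanent_cover _ a δ hδ G hG']

/-- In the used-edge sub-cover every nonzero edge is used. -/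
theorem used_usedEdges (i j : Fin m)
    (hij : (i, j) ∈ E.filter (fun e => a e ≠ 0 ∧ ∃ σ : Equiv.Perm (Fin m),
      (∀ k, (k, σ k) ∈ E ∧ a (k, σ k) ≠ 0) ∧ σ e.1 = e.2)) :
    ∃ τ : Equiv.Perm (Fin m), (∀ k, (k, τ k) ∈ E.filter (fun e => a e ≠ 0 ∧
        ∃ σ : Equiv.Perm (Fin m), (∀ k, (k, σ k) ∈ E ∧ a (k, σ k) ≠ 0) ∧ σ e.1 = e.2) ∧
      a (k, τ k) ≠ 0) ∧ τ i = j := by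
  obtain ⟨-, -, σ, hσ, hσi⟩ := Finset.mem_filter.1 hij
  exact ⟨σ, (good_usedEdges_iff E a σ).2 hσ, hσi⟩

end Used

/-! ### Arithmetic (the strategist's `qp ∘ qp = qp` and `polylog < linear`, from the line skeleton) -/

/-- Exponent bookkeeping (`qp ∘ qp = qp`): if `m ≤ 2^((L + c₀)^c₀)` then
`(Nat.log 2 m + c)^c ≤ (L + K)^K` with `K = (c₀ + 2) * c + c₀ + c + 2`. -/
theorem qp_exponent_le (L c₀ c m : ℕ) (hm : m ≤ 2 ^ ((L + c₀) ^ c₀)) :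
    (Nat.log 2 m + c) ^ c ≤
      (L + ((c₀ + 2) * c + c₀ + c + 2)) ^ ((c₀ + 2) * c + c₀ + c + 2) := by
  set A := (L + c₀) ^ c₀ with hA
  set K := (c₀ + 2) * c + c₀ + c + 2 with hK
  have hlog : Nat.log 2 m ≤ A := by
    calc Nat.log 2 m ≤ Nat.log 2 (2 ^ A) := Nat.log_mono_right hm
      _ = A := Nat.log_pow Nat.one_lt_two _
  set D := L + c₀ + c + 2 with hD
  have hD2 : 2 ≤ D := by omega
  have hD1 : 1 ≤ D := by omega
  have hAD : A ≤ D ^ (c₀ + 1) := by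
    calc A = (L + c₀) ^ c₀ := hA
      _ ≤ D ^ c₀ := Nat.pow_le_pow_left (by omega) c₀
      _ ≤ D ^ c₀ * D := Nat.le_mul_of_pos_right _ (by omega)
      _ = D ^ (c₀ + 1) := (pow_succ D c₀).symm
  have hcD : c ≤ D ^ (c₀ + 1) := by
    calc c ≤ D := by omega
      _ ≤ D ^ (c₀ + 1) := Nat.le_self_pow (by omega) D
  have hbase : Nat.log 2 m + c ≤ D ^ (c₀ + 2) := by
    calc Nat.log 2 m + c ≤ D ^ (c₀ + 1) + D ^ (c₀ + 1) := Nat.add_le_add (le_trans hlog hAD) hcD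
      _ = 2 * D ^ (c₀ + 1) := (two_mul _).symm
      _ ≤ D * D ^ (c₀ + 1) := Nat.mul_le_mul_right _ hD2
      _ = D ^ (c₀ + 2) := by rw [mul_comm, ← pow_succ]
  have hDK : D ≤ L + K := by
    have : c₀ + c + 2 ≤ K := by rw [hK]; omega
    omega
  have hLK : 1 ≤ L + K := le_trans hD1 hDK
  calc (Nat.log 2 m + c) ^ c ≤ (D ^ (c₀ + 2)) ^ c := Nat.pow_le_pow_left hbase c
    _ = D ^ ((c₀ + 2) * c) := by rw [← pow_mul]
    _ ≤ (L + K) ^ ((c₀ + 2) * c) := Nat.pow_le_pow_left hDK _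
    _ ≤ (L + K) ^ K := Nat.pow_le_pow_right hLK (by rw [hK]; omega)

/-- `polylog < linear` at one explicit point: `(t + K)^K < 2^t / 3` for `t = 4K² + 8K + 4`. -/
theorem polylog_lt_two_pow_div_three (K : ℕ) :
    (4 * K * K + 8 * K + 4 + K) ^ K < 2 ^ (4 * K * K + 8 * K + 4) / 3 := by
  set t := 4 * K * K + 8 * K + 4 with ht
  -- t + K ≤ (2K+3)² ≤ 2^(2K+3) · 2^(2K+3) = 2^(4K+6)
  have h1 : t + K ≤ (2 * K + 3) * (2 * K + 3) := by rw [ht]; nlinarith [Nat.zero_le K]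
  have h2 : 2 * K + 3 ≤ 2 ^ (2 * K + 3) := (Nat.lt_two_pow_self).le
  have h3 : t + K ≤ 2 ^ (4 * K + 6) := by
    calc t + K ≤ (2 * K + 3) * (2 * K + 3) := h1
      _ ≤ 2 ^ (2 * K + 3) * 2 ^ (2 * K + 3) := Nat.mul_le_mul h2 h2
      _ = 2 ^ (4 * K + 6) := by rw [← pow_add]; ring_nf
  have h4 : (t + K) ^ K ≤ 2 ^ ((4 * K + 6) * K) := by
    calc (t + K) ^ K ≤ (2 ^ (4 * K + 6)) ^ K := Nat.pow_le_pow_left h3 K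
      _ = 2 ^ ((4 * K + 6) * K) := by rw [← pow_mul]
  -- ((t+K)^K + 1) * 3 ≤ 2^((4K+6)K + 3) ≤ 2^t
  have h5 : (4 * K + 6) * K + 3 ≤ t := by rw [ht]; nlinarith [Nat.zero_le K]
  have h6 : ((t + K) ^ K + 1) * 3 ≤ 2 ^ t := by
    have hp : 1 ≤ 2 ^ ((4 * K + 6) * K) := Nat.one_le_two_pow
    calc ((t + K) ^ K + 1) * 3 ≤ (2 ^ ((4 * K + 6) * K) + 2 ^ ((4 * K + 6) * K)) * 4 :=
          Nat.mul_le_mul (Nat.add_le_add h4 hp) (by norm_num)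
      _ = 2 ^ ((4 * K + 6) * K + 3) := by ring
      _ ≤ 2 ^ t := Nat.pow_le_pow_right Nat.two_pos h5
  have h7 : (t + K) ^ K + 1 ≤ 2 ^ t / 3 := (Nat.le_div_iff_mul_le (by norm_num)).2 h6
  omega


/-- Arithmetic: `m ^ Y ≤ 2 ^ ((log₂ m + 1) * Y)`. -/
theorem pow_le_two_pow_log_succ_mul (m Y : ℕ) : m ^ Y ≤ 2 ^ ((Nat.log 2 m + 1) * Y) := by
  calc m ^ Y ≤ (2 ^ (Nat.log 2 m + 1)) ^ Y :=
        Nat.pow_le_pow_left (Nat.lt_pow_succ_log_self Nat.one_lt_two m).le Y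
    _ = 2 ^ ((Nat.log 2 m + 1) * Y) := by rw [← pow_mul]

/-- Arithmetic: `(L + 1) (L + d)^d ≤ (L + (d + 1))^(d + 1)`. -/
theorem succ_mul_pow_le_pow_succ (L d : ℕ) : (L + 1) * (L + d) ^ d ≤ (L + (d + 1)) ^ (d + 1) := by
  calc (L + 1) * (L + d) ^ d ≤ (L + (d + 1)) * (L + (d + 1)) ^ d :=
        Nat.mul_le_mul (by omega) (Nat.pow_le_pow_left (by omega) d)
    _ = (L + (d + 1)) ^ (d + 1) := (pow_succ' _ _).symm

/-- **`WidthBet → MonotoneCoverHard`.**  If, uniformly, every label-bijective Pfaffian cover of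
`per_n` (`n ≥ n₀`) has, for every level function on its used edges, a balanced level `h ≥ 1` whose two
adjacent widths total at most `(log₂ m + d)^d`, then no quasi-polynomial family of label-bijective
Pfaffian covers of the permanent exists. -/
theorem monotoneCoverHard_of_widthBet
    (hbet : ∃ d n₀ : ℕ, ∀ (n m : ℕ) (E : Finset (Fin m × Fin m))
      (a : Fin m × Fin m → MvPolynomial (Fin n × Fin n) ℂ), n₀ ≤ n →
      (∃ s : Fin m × Fin m → ℂ, (∀ e, s e = 1 ∨ s e = -1) ∧
        (Matrix.of fun i j => if (i, j) ∈ E then MvPolynomial.C (s (i, j)) * MvPolynomial.X (i, j)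
            else 0 : Matrix (Fin m) (Fin m) (MvPolynomial (Fin m × Fin m) ℂ)).det =
          (Matrix.of fun i j => if (i, j) ∈ E then MvPolynomial.X (i, j) else 0 :
            Matrix (Fin m) (Fin m) (MvPolynomial (Fin m × Fin m) ℂ)).permanent) →
      (∀ e, (∃ j, a e = MvPolynomial.X j) ∨ a e = 0 ∨ a e = 1) →
      Literature.Computability.AlgebraicComplexity.perPoly (Fin n) ℂ =
        MvPolynomial.aeval a (Matrix.of fun i j => if (i, j) ∈ E then MvPolynomial.X (i, j) else 0 :
            Matrix (Fin m) (Fin m) (MvPolynomial (Fin m × Fin m) ℂ)).permanent →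
      ∀ g : Fin m ⊕ Fin m → ℕ,
        (∀ τ : Equiv.Perm (Fin m), (∀ i, (i, τ i) ∈ E ∧ a (i, τ i) ≠ 0) → ∀ i,
          (∃ k, a (i, τ i) = MvPolynomial.X k) → g (Sum.inr (τ i)) = g (Sum.inl i) + 1) →
        (∀ τ : Equiv.Perm (Fin m), (∀ i, (i, τ i) ∈ E ∧ a (i, τ i) ≠ 0) → ∀ i,
          (¬ ∃ k, a (i, τ i) = MvPolynomial.X k) → g (Sum.inr (τ i)) = g (Sum.inl i)) →
        ∃ h ch cq : ℕ, 1 ≤ h ∧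
          (∀ τ : Equiv.Perm (Fin m), (∀ i, (i, τ i) ∈ E ∧ a (i, τ i) ≠ 0) →
            n ≤ 3 * (Finset.univ.filter fun i : Fin m =>
                (∃ k, a (i, τ i) = MvPolynomial.X k) ∧ g (Sum.inl i) < h).card ∧
              3 * (Finset.univ.filter fun i : Fin m =>
                (∃ k, a (i, τ i) = MvPolynomial.X k) ∧ g (Sum.inl i) < h).card ≤ 2 * n) ∧
          (∀ τ : Equiv.Perm (Fin m), (∀ i, (i, τ i) ∈ E ∧ a (i, τ i) ≠ 0) →
            (Finset.univ.filter fun i : Fin m =>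
              (∃ k, a (i, τ i) = MvPolynomial.X k) ∧ g (Sum.inl i) = h).card = ch) ∧
          (∀ τ : Equiv.Perm (Fin m), (∀ i, (i, τ i) ∈ E ∧ a (i, τ i) ≠ 0) →
            (Finset.univ.filter fun i : Fin m =>
              (∃ k, a (i, τ i) = MvPolynomial.X k) ∧ g (Sum.inl i) = h - 1).card = cq) ∧
          ch + cq ≤ (Nat.log 2 m + d) ^ d) :
    MonotoneCoverHard := by
  obtain ⟨d, n₀, hd⟩ := hbet
  rintro ⟨c₀, hc₀⟩
  set c := d + 1 with hc
  set K := (c₀ + 2) * c + c₀ + c + 2 + n₀ with hK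
  set t := 4 * K * K + 8 * K + 4 with ht
  obtain ⟨m, hm, E, P, hP, ⟨s, hs, hdet⟩, a, ha, hper⟩ := hc₀ (2 ^ t)
  have hsig : ∃ s : Fin m × Fin m → ℂ, (∀ e, s e = 1 ∨ s e = -1) ∧
      (Matrix.of fun i j => if (i, j) ∈ E then MvPolynomial.C (s (i, j)) * MvPolynomial.X (i, j)
          else 0 : Matrix (Fin m) (Fin m) (MvPolynomial (Fin m × Fin m) ℂ)).det =
        (Matrix.of fun i j => if (i, j) ∈ E then MvPolynomial.X (i, j) else 0 :
          Matrix (Fin m) (Fin m) (MvPolynomial (Fin m × Fin m) ℂ)).permanent :=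
    ⟨s, hs, hdet.trans hP⟩
  have hper' : Literature.Computability.AlgebraicComplexity.perPoly (Fin (2 ^ t)) ℂ =
      MvPolynomial.aeval a (Matrix.of fun i j => if (i, j) ∈ E then MvPolynomial.X (i, j) else 0 :
          Matrix (Fin m) (Fin m) (MvPolynomial (Fin m × Fin m) ℂ)).permanent := by
    rw [hper, hP]
  have hKt : K ≤ t := by rw [ht]; nlinarith [Nat.zero_le K]
  have hn₀ : n₀ ≤ 2 ^ t :=
    le_trans (by rw [hK]; omega) (le_trans hKt (Nat.lt_two_pow_self).le)
  -- the used-edge sub-cover and its level function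
  set E' := E.filter (fun e => a e ≠ 0 ∧ ∃ σ : Equiv.Perm (Fin m),
    (∀ k, (k, σ k) ∈ E ∧ a (k, σ k) ≠ 0) ∧ σ e.1 = e.2) with hE'
  have hper'' := perIdentity_usedEdges E a ha hper'
  obtain ⟨g, hvar', hone'⟩ := exists_level_function (2 ^ t) m E' a ha hper''
    (fun i j hij _ => used_usedEdges E a i j hij)
  -- the bet, applied to the (Pfaffian) cover with this level function on its used edges
  obtain ⟨h, ch, cq, h1, hwin, hch, hcq, hwidth⟩ := hd (2 ^ t) m E a hn₀ hsig ha hper' g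
    (fun τ hτ i hv => hvar' i (τ i) (((good_usedEdges_iff E a τ).2 hτ i).1) hv)
    (fun τ hτ i hnv => hone' i (τ i) (((good_usedEdges_iff E a τ).2 hτ i).1) (hτ i).2 hnv)
  -- the width rung on the used-edge sub-cover
  have hlow := two_pow_le_pow_width_of_labels (2 ^ t) m E' a ha hper'' g h ch cq h1 hvar' hone'
    (fun τ hτ => hwin τ ((good_usedEdges_iff E a τ).1 hτ))
    (fun τ hτ => hch τ ((good_usedEdges_iff E a τ).1 hτ))
    (fun τ hτ => hcq τ ((good_usedEdges_iff E a τ).1 hτ))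
  -- arithmetic: 2^(2^t/3) ≤ m^(ch+cq) ≤ 2^((log m + 1)(log m + d)^d) ≤ 2^((log m + c)^c) ≤ 2^((t+K)^K)
  have hlogn : Nat.log 2 (2 ^ t) = t := Nat.log_pow Nat.one_lt_two _
  have hexp : (Nat.log 2 m + c) ^ c ≤ (t + K) ^ K := by
    have h1' := qp_exponent_le t c₀ c m (by simpa [hlogn] using hm)
    have hK₀ : (c₀ + 2) * c + c₀ + c + 2 ≤ K := by rw [hK]; omega
    have ht1 : 1 ≤ t + K := by rw [ht]; omega
    calc (Nat.log 2 m + c) ^ c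
        ≤ (t + ((c₀ + 2) * c + c₀ + c + 2)) ^ ((c₀ + 2) * c + c₀ + c + 2) := h1'
      _ ≤ (t + K) ^ ((c₀ + 2) * c + c₀ + c + 2) := Nat.pow_le_pow_left (by omega) _
      _ ≤ (t + K) ^ K := Nat.pow_le_pow_right ht1 hK₀
  have hmY : m ^ (ch + cq) ≤ 2 ^ ((Nat.log 2 m + 1) * (Nat.log 2 m + d) ^ d) := by
    rcases Nat.eq_zero_or_pos m with hm0 | hm0
    · subst hm0
      exact (pow_le_one₀ le_rfl zero_le_one).trans Nat.one_le_two_pow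
    · exact (Nat.pow_le_pow_right hm0 hwidth).trans (pow_le_two_pow_log_succ_mul m _)
  have hchain : 2 ^ (2 ^ t / 3) ≤ 2 ^ ((t + K) ^ K) := by
    calc 2 ^ (2 ^ t / 3) ≤ m ^ (ch + cq) := hlow
      _ ≤ 2 ^ ((Nat.log 2 m + 1) * (Nat.log 2 m + d) ^ d) := hmY
      _ ≤ 2 ^ ((Nat.log 2 m + c) ^ c) := by
          rw [hc]; exact Nat.pow_le_pow_right Nat.two_pos (succ_mul_pow_le_pow_succ _ _)
      _ ≤ 2 ^ ((t + K) ^ K) := Nat.pow_le_pow_right Nat.two_pos hexp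
  have hle : 2 ^ t / 3 ≤ (t + K) ^ K := (Nat.pow_le_pow_iff_right Nat.one_lt_two).1 hchain
  have hlt := polylog_lt_two_pow_div_three K
  rw [← ht] at hlt
  omega

end Summit.ValiantsHypothesis.ValiantsHypothesis.Theorems.PolyaContinuedMonotoneCoverHard
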